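import Summits.BirchSwinnertonDyer.BirchSwinnertonDyer.Theses.ByReductionTypeAtTwo
import Summits.BirchSwinnertonDyer.BirchSwinnertonDyer.Theorems.ByReductionTypeAtTwoMultUpperHalfKatoIntSplit
import Summits.BirchSwinnertonDyer.BirchSwinnertonDyer.Theorems.ByReductionTypeAtTwoMultUpperHalfKatoIntSplitDefs
import Summits.BirchSwinnertonDyer.BirchSwinnertonDyer.Theorems.ByReductionTypeAtTwoMultUpperHalfCloses
import HarnessLib

/-!
# Line `four-roads` (reshaped to SIX roads, 7 stubs) — skeleton for crux `MultUpperHalfAtTwo`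
# (item stmt-BirchSwinnertonDyer-19922, route ByReductionTypeAtTwo, rung K4, rank 302; lane `bsd-2adic-mult-2`)

The crux (`ord₂ #Ш[2^∞] ≤ ord₂ #Ш_an` for every non-CM `E/ℚ` of analytic rank `0` MULTIPLICATIVE at `2`;
1 969 rank-0 book230 classes) from SEVEN stubs, composed by the landed SIX-road reduction
`Theorems.multUpperHalfAtTwo_of_sixRoads'` (seat mult-2 GEN 3, p436133; named glue
`multUpperHalfAtTwo_of_leaves_sixRoads_bundled'` p436578; leaves p425255 / p428463 / p434976 + p436173; roads p418902, p424960,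
p427239, p429114, p429063, p430028, split door p433154 of seat mult GEN 7, memo PROOF-KATO2SPLIT). RESHAPE of the
registered 6-stub skeleton (planner draft e94ed4dd): the WALL `stub_offFourRoads` (759 classes) is replaced by
`stub_katoIntSpSurj` (MEMO, one memo: the split integral door, sharp + slack one) and the smaller WALL `stub_offSixRoads`
(194 classes); the five other stubs are unchanged (names AND signatures).

* `stub_pub` — PUBLISHED ×8 (closed by citation; GUARDED Thm-4.1 analogue `…_anyPrime_oddLocalDegree`, audit N-1).
* `stub_gsSplit` — MEMO: Greenberg–Stevens at a split multiplicative `2` (mult/PROOF-GS2.md, RC-4 PASS).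
* `stub_katoRat` — MEMO: Kato's divisibility ⊗ℚ at a multiplicative `2` (mult/PROOF-MULT.md, RC-2 PASS; = K11a).
* `stub_katoIntNsSurj` — MEMO: integral Kato at a non-split `2`, surjective `ρ_{E,2}`, `Δ < 0` (T-KATO2-NSMULT, RC-32 PASS).
* `stub_katoUpToOne` — MEMO: the same at slack one, both signs (same memo).
* `stub_katoIntSpSurj` — MEMO: integral Kato AWAY FROM THE TRIVIAL ZERO at a SPLIT `2`, surjective `ρ_{E,2}`: sharp on
  `Δ < 0` ∧ slack one for both signs (T-KATO2-SPMULT, mult/PROOF-KATO2SPLIT.md v1 @7caaefd9 + ADDENDUM-1, RC requested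
  2026-08-26T08:48Z).
* `stub_offSixRoads` — WALL / residual-grade: the upper half OFF the six roads (census 194 / 1 969 r0 classes = 52 small
  `2`-adic image (no Euler-system door: Rubin's Hyp(ℚ_∞,T) fails) + 142 «neither» (reducible `E[2]`, optimal curve
  neither ramified nor odd)) — MATH-BOUND as typed (`μ(X(E₀/ℚ_∞)) = 0`, not in print); declared residual of the line;
  the TOWER road (`Theorems/ByReductionTypeAtTwoMultUpperHalfTower.lean`, p436130) is its only certificate route.
Census (r0, CENSUS-6 + mult-2 CENSUS-upper-roads v2 + CENSUS-tower-road-mult): ON a road modulo the MEMO stubs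
1 775 / 1 969 = 154 optimal-5.14 + 808 sharp non-split + 248 non-split parity + 436 sharp split + 129 split parity;
residual 194.
-/

set_option autoImplicit false
-- the Cruxes namespace of this sub repeats the summit name by design (D-0017 nested layout)
set_option linter.dupNamespace false

noncomputable section

open scoped Classical

open WeierstrassCurve Literature.NumberTheory.EllipticCurves
  Literature.NumberTheory.EllipticCurves.ModularForms
  Literature.NumberTheory.EllipticCurves.Greenberg1999
  Literature.NumberTheory.EllipticCurves.Rank1Residual
  Literature.NumberTheory.EllipticCurves.Rank1Residual.Typed
  Summit.BirchSwinnertonDyer.Rank1Residual.X5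
  Summit.BirchSwinnertonDyer.BirchSwinnertonDyer.Theorems

namespace Summit.BirchSwinnertonDyer.BirchSwinnertonDyer.Cruxes.MultUpperHalfAtTwo

namespace FourRoads

/-- stub (1): the eight PUBLISHED inputs (closed by citation; the Thm-4.1 non-split analogue in its GUARDED form). -/
theorem stub_pub :
    thm41Analogue_charValue_rankZero_numberField_anyPrime_oddLocalDegree ∧
      thm41Analogue_charValue_rankZero_split_baseChange_anyPrime ∧
      nonempty_modularParametrizationData ∧ rank_eq_analyticRank_of_analyticRank_le_one ∧
      bsdRHS_eq_of_isIsogenous ∧ prop514_isTorsion_mu_eq_zero_two ∧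
      cesnavicius_not_two_dvd_maninConstant_of_two_dvd_level ∧
      WeierstrassCurve.exists_casselsTate_pairing (K := ℚ) := by
  sorry

/-- stub (2): MEMO — Greenberg–Stevens at a split multiplicative `2`. -/
theorem stub_gsSplit : MultUpperHalvesAtTwo.GreenbergStevensAtSplitTwo := by
  sorry

/-- stub (3): MEMO — Kato's divisibility ⊗ℚ at a multiplicative `2` (K11a-shaped; no print at `2 ∣ N`). -/
theorem stub_katoRat : MultUpperHalvesAtTwo.KatoRatAtMultTwo := by
  sorry

/-- stub (4): MEMO — integral Kato divisibility at a non-split `2`, surjective `ρ_{E,2}`, `Δ < 0` (T-KATO2-NSMULT). -/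
theorem stub_katoIntNsSurj : MultUpperHalvesAtTwo.KatoIntAtNonsplitSurjectiveTwo := by
  sorry

/-- stub (5): MEMO — the up-to-one-step non-split divisibility on the same habitat, both signs of `Δ`. -/
theorem stub_katoUpToOne : MultUpperHalvesAtTwo.KatoUpToOneAtNonsplitSurjectiveTwo := by
  sorry

/-- stub (6): MEMO — integral Kato divisibility away from the trivial zero at a SPLIT `2`, surjective `ρ_{E,2}`:
sharp (`Δ < 0`) ∧ slack one (both signs) — T-KATO2-SPMULT (mult/PROOF-KATO2SPLIT.md, RC requested). -/
theorem stub_katoIntSpSurj :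
    MultUpperHalvesAtTwo.KatoIntAtSplitSurjectiveTwo ∧ MultUpperHalvesAtTwo.KatoUpToOneAtSplitSurjectiveTwo := by
  sorry

/-- stub (7): WALL — the upper half OFF the six roads (194 r0 classes: 52 small `2`-adic image + 142 «neither»);
residual-grade, MATH-BOUND as typed (`μ(X(E₀/ℚ_∞)) = 0`); its only certificate route is the TOWER road. -/
theorem stub_offSixRoads : MultUpperHalvesAtTwo.UpperHalfOffSixRoadsAtMultTwo := by
  sorry

/-- composition = THE SKELETON: the crux BY NAME from exactly the seven registered stubs, ONE application of the
landed six-road reduction `Theorems.multUpperHalfAtTwo_of_sixRoads'` (p436133; the leaves unfold to its binders by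
`rfl`; = the named glue `multUpperHalfAtTwo_of_leaves_sixRoads_bundled'`, p436578). Kernel-checked, no sorry of its own. -/
theorem MultUpperHalfAtTwo_of :
    (thm41Analogue_charValue_rankZero_numberField_anyPrime_oddLocalDegree ∧
      thm41Analogue_charValue_rankZero_split_baseChange_anyPrime ∧
      nonempty_modularParametrizationData ∧ rank_eq_analyticRank_of_analyticRank_le_one ∧
      bsdRHS_eq_of_isIsogenous ∧ prop514_isTorsion_mu_eq_zero_two ∧
      cesnavicius_not_two_dvd_maninConstant_of_two_dvd_level ∧
      WeierstrassCurve.exists_casselsTate_pairing (K := ℚ)) →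
    MultUpperHalvesAtTwo.GreenbergStevensAtSplitTwo → MultUpperHalvesAtTwo.KatoRatAtMultTwo →
    MultUpperHalvesAtTwo.KatoIntAtNonsplitSurjectiveTwo → MultUpperHalvesAtTwo.KatoUpToOneAtNonsplitSurjectiveTwo →
    (MultUpperHalvesAtTwo.KatoIntAtSplitSurjectiveTwo ∧ MultUpperHalvesAtTwo.KatoUpToOneAtSplitSurjectiveTwo) →
    MultUpperHalvesAtTwo.UpperHalfOffSixRoadsAtMultTwo →
    Summit.BirchSwinnertonDyer.BirchSwinnertonDyer.Theses.ByReductionTypeAtTwo.MultUpperHalfAtTwo :=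
  fun ⟨h41ns', h41sp, hmod, hGZK, hCassels, h514, hC, hCT⟩ hGS hKato hKint hK1 ⟨hKintSp, hK1sp⟩ hoff =>
    multUpperHalfAtTwo_of_sixRoads' hKato h41ns' h41sp hmod hGZK hCassels h514 hC hCT hGS hKint hK1 hKintSp hK1sp hoff

/-- the crux outright from the stubs (same term; what `ledger skeleton check` composes). -/
theorem MultUpperHalfAtTwo_holds_of_stubs :
    Summit.BirchSwinnertonDyer.BirchSwinnertonDyer.Theses.ByReductionTypeAtTwo.MultUpperHalfAtTwo :=
  MultUpperHalfAtTwo_of stub_pub stub_gsSplit stub_katoRat stub_katoIntNsSurj stub_katoUpToOne stub_katoIntSpSurj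
    stub_offSixRoads

end FourRoads

end Summit.BirchSwinnertonDyer.BirchSwinnertonDyer.Cruxes.MultUpperHalfAtTwo

end
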